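import Literature.NumberTheory.GaloisRepresentations.HeckeLFunctionEntireContinuationShiftProofs
import Literature.NumberTheory.GaloisRepresentations.CMTypeHeckeCharacter
import HarnessLib

/-!
# The infinity type of a Hecke character on a totally complex field controls its exponent and rules out norm
# twists; hence `L(s, χ)` is entire for a character of non-parallel type and non-positive total weight
# (Weil 1956 §1; Tate 1950, Thm. 4.4.1)

Topic `NumberTheory/GaloisRepresentations`, namespace `Literature.NumberTheory.GaloisRepresentations.HeckeCharacter`;
sequel of `HeckeLFunctionEntireContinuationShiftProofs` (entire continuation for a non-norm-twist character of
non-negative exponent) and of `AlgebraicHeckeCharacterGrossencharakterProofs` (`HasInfinityType`). PROOFS ONLY (no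
definition, no named fact, no `sorry`). Requested by the Katz–Hsieh layer of route `BiquadraticEisensteinDescent`
(`Summits/BirchSwinnertonDyer`, crux `EisensteinHeartFlatCMInertBadKPrime`, hypothesis (C) of
`…KatzHsiehDisplay.display_relation`): the branch characters `λ·ρ` of the Katz frames have type `kΣ + κ(1 − c)`,
`k ≥ 1` — total weight `−k` at every complex place and non-parallel type — so their `L`-functions are entire by the
results below, WITHOUT any analytic input beyond Tate's theorem (proved in the tree).

## What is proved (all for `K` TOTALLY COMPLEX; the test ideles are built through `K_w ≅ ℂ` =
## `ringEquivComplexOfIsComplex`, and every infinite idele is totally positive, so the infinity type governs `χ` on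
## all of them, `HasInfinityType.apply_infiniteIdeles_eq`)

* `not_isNormTwist_of_hasInfinityType_of_sum_ne` — if `χ` has infinity type `(p, q)` with `∑_w p_w ≠ ∑_w q_w` then
  `χ` is not a norm twist: at the diagonal idele `z = e^{iπ/d}`, `d = ∑_w (q_w − p_w)`, a norm twist takes the value
  `1` (the idele has norm `1`) while the type gives `∏_w z^{−p_w} z̄^{−q_w} = e^{iπ} = −1`.
* `not_isNormTwist_of_hasInfinityType_of_ne` — the sharper single-place form: `p_{w₀} ≠ q_{w₀}` at ONE place suffices
  (test idele with coordinate `e^{iπ/d}` at `w₀` and `1` elsewhere, `d = q_{w₀} − p_{w₀}`; built with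
  `MonoidHom.mulSingle`).
* `two_mul_exponent_eq_of_hasInfinityType` — if `‖χ(y)‖ = ‖y‖^σ` (the exponent of `χ`) then
  `2σ = −(p_{w₀} + q_{w₀})` at EVERY place `w₀` (coordinate `2` at `w₀`: the two sides are `4^σ` and `2^{−(p+q)}`).
* **`hasEntireContinuation_heckeLFunction_of_hasInfinityType`** — if `p_{w₀} ≠ q_{w₀}` and `p_{w₀} + q_{w₀} ≤ 0` at
  one place then `L(s, χ)` has an entire continuation (`σ ≥ 0` by the previous item;
  `hasEntireContinuation_heckeLFunction_of_norm_eq_rpow`). For a Katz type `kΣ + κ(1 − c)` (`k ≥ 1`, `κ ≥ 0`) at any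
  place `{p_w, q_w} = {−(k+κ_w), κ_w}`: `p_w ≠ q_w` and `p_w + q_w = −k ≤ 0`, whatever Mathlib's choice of
  `w.embedding`. (The tree's `CycTangentCMCycTangentBoundInterpolationContinuation.hasEntireContinuation_of_hasInfinityType`
  is the imaginary quadratic, constant-type case; `IwasawaTwoVariable.not_isNormTwist_of_hasInfinityType` the
  constant-type `(n, −n)` case.)

References: [Weil1956] §1; [TateThesis1967] Thm. 4.4.1; [WeilBNT1967] Ch. VII §3; Serre 1968 Ch. II §2.
-/

noncomputable section

open scoped NumberField ComplexConjugate
open NumberField InfinitePlace NumberField.InfinitePlace.Completion IsDedekindDomain Filter Complex Finset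

namespace Literature.NumberTheory.GaloisRepresentations

namespace HeckeCharacter

variable {K : Type} [Field K] [NumberField K]

/-- **Non-parallel infinity type ⇒ not a norm twist** (totally complex `K`): if `χ` has infinity type `(p, q)` with
`∑_w p_w ≠ ∑_w q_w`, then `χ` is not of the form `‖·‖^z`. Test idele: all coordinates `e^{iπ/d}`,
`d = ∑_w (q_w − p_w) ≠ 0`; it has idele norm `1`, so a norm twist is `1` on it, while the type gives
`∏_w e^{−iπ p_w/d} e^{iπ q_w/d} = e^{iπ} = −1`. [cite: Weil1956, §1] [cite: TateThesis1967, §4.4] -/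
theorem not_isNormTwist_of_hasInfinityType_of_sum_ne [IsTotallyComplex K] {χ : HeckeCharacter K}
    {p q : InfinitePlace K → ℤ} (h : χ.HasInfinityType p q) (hne : ∑ w, p w ≠ ∑ w, q w) :
    ¬ χ.IsNormTwist := by
  classical
  rintro ⟨z₀, hz₀⟩
  set d : ℤ := ∑ w, (q w - p w) with hd
  have hd0 : d ≠ 0 := by
    rw [hd, Finset.sum_sub_distrib]
    exact sub_ne_zero.mpr (Ne.symm hne)
  -- the angle and the point `z = exp(θ I)`
  set θ : ℝ := Real.pi / (d : ℝ) with hθ_def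
  set z : ℂ := Complex.exp ((θ : ℂ) * Complex.I) with hz_def
  have hz0 : z ≠ 0 := Complex.exp_ne_zero _
  -- the diagonal infinite idele with all coordinates `z`
  let ρ : ℂ →+* InfiniteAdeleRing K :=
    RingHom.pi fun w : InfinitePlace K =>
      ((ringEquivComplexOfIsComplex (IsTotallyComplex.isComplex w)).symm : ℂ ≃+* w.Completion).toRingHom
  let x : (InfiniteAdeleRing K)ˣ := Units.map (ρ : ℂ →* InfiniteAdeleRing K) (Units.mk0 z hz0)
  have hxw : ∀ w : InfinitePlace K, extensionEmbedding w ((x : InfiniteAdeleRing K) w) = z := by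
    intro w
    show extensionEmbedding w
      ((ringEquivComplexOfIsComplex (IsTotallyComplex.isComplex w)).symm z) = z
    rw [← ringEquivComplexOfIsComplex_apply (IsTotallyComplex.isComplex w), RingEquiv.apply_symm_apply]
  have hpos : InfiniteIdele.IsTotallyPositive x := fun w hw =>
    absurd hw (not_isReal_iff_isComplex.mpr (IsTotallyComplex.isComplex w))
  have key := h.apply_infiniteIdeles_eq hpos
  -- the idele norm of `x` is `1`, so the norm twist is `1` on it
  have hnormw : ∀ w : InfinitePlace K, ‖(x : InfiniteAdeleRing K) w‖ = 1 := by
    intro w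
    have hiso := (isometry_extensionEmbedding w).norm_map_of_map_zero (map_zero _)
      ((x : InfiniteAdeleRing K) w)
    rw [← hiso, hxw, hz_def, Complex.norm_exp_ofReal_mul_I]
  have hN : ideleNorm (infiniteIdeles K x) = 1 := by
    rw [ideleNorm_infiniteIdeles']
    exact Finset.prod_eq_one fun w _ => by rw [hnormw, one_pow]
  have h1 : ((χ (infiniteIdeles K x) : ℂˣ) : ℂ) = 1 := by
    rw [hz₀, hN, Complex.ofReal_one, Complex.one_cpow]
  rw [h1, archFactor_apply] at key
  simp_rw [hxw] at key
  -- compute the factor: `z^{-p_w} · conj(z)^{-q_w} = exp((q_w - p_w) θ I)`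
  have hconj : conj z = Complex.exp (-((θ : ℂ) * Complex.I)) := by
    rw [hz_def, ← Complex.exp_conj, map_mul, Complex.conj_ofReal, Complex.conj_I, mul_neg]
  have hfac : ∀ w : InfinitePlace K,
      z ^ (-p w) * conj z ^ (-q w) = Complex.exp ((((q w - p w : ℤ)) : ℂ) * ((θ : ℂ) * Complex.I)) := by
    intro w
    rw [hconj, hz_def, ← Complex.exp_int_mul, ← Complex.exp_int_mul, ← Complex.exp_add]
    congr 1
    push_cast
    ring
  simp_rw [hfac] at key
  rw [← Complex.exp_sum, ← Finset.sum_mul] at key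
  -- `∑_w (q_w - p_w) · θ I = π I`
  have hsum : (∑ w : InfinitePlace K, (((q w - p w : ℤ)) : ℂ)) = (d : ℂ) := by
    rw [hd]; push_cast; rfl
  have hd' : (d : ℂ) ≠ 0 := Int.cast_ne_zero.mpr hd0
  have harg : (∑ w : InfinitePlace K, (((q w - p w : ℤ)) : ℂ)) * ((θ : ℂ) * Complex.I) =
      (Real.pi : ℂ) * Complex.I := by
    rw [hsum, hθ_def]
    push_cast
    field_simp
  rw [harg, Complex.exp_pi_mul_I] at key
  norm_num at key

/-- **One place with `p_w ≠ q_w` ⇒ not a norm twist** (totally complex `K`): if `χ` has infinity type `(p, q)` and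
`p_{w₀} ≠ q_{w₀}` at some infinite place `w₀`, then `χ` is not of the form `‖·‖^z`. Test idele: coordinate `e^{iπ/d}`
at `w₀` (`d = q_{w₀} − p_{w₀}`) and `1` elsewhere; its idele norm is `1`, so a norm twist is `1` on it, while the
type gives `e^{−iπp/d} e^{iπq/d} = e^{iπ} = −1`. (Sharper than the `∑p ≠ ∑q` form: the defects at different places
cannot cancel.) [cite: Weil1956, §1] [cite: TateThesis1967, §4.4] -/
theorem not_isNormTwist_of_hasInfinityType_of_ne [IsTotallyComplex K] {χ : HeckeCharacter K}
    {p q : InfinitePlace K → ℤ} (h : χ.HasInfinityType p q) (w₀ : InfinitePlace K) (hw : p w₀ ≠ q w₀) :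
    ¬ χ.IsNormTwist := by
  classical
  rintro ⟨z₀, hz₀⟩
  set d : ℤ := q w₀ - p w₀ with hd
  have hd0 : d ≠ 0 := sub_ne_zero.mpr (Ne.symm hw)
  set θ : ℝ := Real.pi / (d : ℝ) with hθ_def
  set z : ℂ := Complex.exp ((θ : ℂ) * Complex.I) with hz_def
  have hz0 : z ≠ 0 := Complex.exp_ne_zero _
  -- the infinite idele with coordinate `z` at `w₀` and `1` elsewhere
  let e : ℂ ≃+* w₀.Completion := (ringEquivComplexOfIsComplex (IsTotallyComplex.isComplex w₀)).symm
  let ρ : ℂ →* InfiniteAdeleRing K :=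
    (MonoidHom.mulSingle (fun w : InfinitePlace K ↦ w.Completion) w₀).comp (e : ℂ →+* w₀.Completion).toMonoidHom
  let x : (InfiniteAdeleRing K)ˣ := Units.map ρ (Units.mk0 z hz0)
  have hx₀ : (x : InfiniteAdeleRing K) w₀ = e z := by
    show Pi.mulSingle (M := fun w : InfinitePlace K ↦ w.Completion) w₀ (e z) w₀ = e z
    exact Pi.mulSingle_eq_same w₀ (e z)
  have hx₁ : ∀ w : InfinitePlace K, w ≠ w₀ → (x : InfiniteAdeleRing K) w = 1 := fun w hw' ↦ by
    show Pi.mulSingle (M := fun w : InfinitePlace K ↦ w.Completion) w₀ (e z) w = 1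
    exact Pi.mulSingle_eq_of_ne hw' _
  have hxw₀ : extensionEmbedding w₀ ((x : InfiniteAdeleRing K) w₀) = z := by
    rw [hx₀]
    show extensionEmbedding w₀ ((ringEquivComplexOfIsComplex (IsTotallyComplex.isComplex w₀)).symm z) = z
    rw [← ringEquivComplexOfIsComplex_apply (IsTotallyComplex.isComplex w₀), RingEquiv.apply_symm_apply]
  have hxw : ∀ w : InfinitePlace K, w ≠ w₀ → extensionEmbedding w ((x : InfiniteAdeleRing K) w) = 1 :=
    fun w hw' ↦ by rw [hx₁ w hw', map_one]
  have hpos : InfiniteIdele.IsTotallyPositive x := fun w hw' =>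
    absurd hw' (not_isReal_iff_isComplex.mpr (IsTotallyComplex.isComplex w))
  have key := h.apply_infiniteIdeles_eq hpos
  -- idele norm `1`
  have hnormw : ∀ w : InfinitePlace K, ‖(x : InfiniteAdeleRing K) w‖ = 1 := by
    intro w
    have hiso := (isometry_extensionEmbedding w).norm_map_of_map_zero (map_zero _)
      ((x : InfiniteAdeleRing K) w)
    rw [← hiso]
    by_cases hw' : w = w₀
    · subst hw'
      rw [hxw₀, hz_def, Complex.norm_exp_ofReal_mul_I]
    · rw [hxw w hw', norm_one]
  have hN : ideleNorm (infiniteIdeles K x) = 1 := by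
    rw [ideleNorm_infiniteIdeles']
    exact Finset.prod_eq_one fun w _ => by rw [hnormw, one_pow]
  have h1 : ((χ (infiniteIdeles K x) : ℂˣ) : ℂ) = 1 := by
    rw [hz₀, hN, Complex.ofReal_one, Complex.one_cpow]
  rw [h1, archFactor_apply, Finset.prod_eq_single w₀ (fun w _ hw' ↦ by
    rw [hxw w hw', map_one, one_zpow, one_zpow, mul_one]) (fun h' ↦ absurd (Finset.mem_univ w₀) h'),
    hxw₀] at key
  -- `z^{-p} · conj(z)^{-q} = exp((q - p) θ I) = exp(π I) = -1`
  have hconj : conj z = Complex.exp (-((θ : ℂ) * Complex.I)) := by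
    rw [hz_def, ← Complex.exp_conj, map_mul, Complex.conj_ofReal, Complex.conj_I, mul_neg]
  have hfac : z ^ (-p w₀) * conj z ^ (-q w₀) = Complex.exp ((((q w₀ - p w₀ : ℤ)) : ℂ) * ((θ : ℂ) * Complex.I)) := by
    rw [hconj, hz_def, ← Complex.exp_int_mul, ← Complex.exp_int_mul, ← Complex.exp_add]
    congr 1
    push_cast
    ring
  have hd' : (d : ℂ) ≠ 0 := Int.cast_ne_zero.mpr hd0
  have harg : (((q w₀ - p w₀ : ℤ)) : ℂ) * ((θ : ℂ) * Complex.I) = (Real.pi : ℂ) * Complex.I := by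
    rw [← hd, hθ_def]
    push_cast
    field_simp
  rw [hfac, harg, Complex.exp_pi_mul_I] at key
  norm_num at key

/-- **The infinity type determines the exponent, place by place** (totally complex `K`): if `χ` has infinity type
`(p, q)` and `‖χ(y)‖ = ‖y‖^σ` for all ideles `y` (the exponent of `χ`), then `2σ = −(p_{w₀} + q_{w₀})` at EVERY
infinite place `w₀` (so `p_w + q_w` is the same at all places — minus the weight). Test idele: coordinate `2` at
`w₀`, `1` elsewhere: idele norm `2² = 4`, `‖χ‖ = 2^{−(p+q)}`. [cite: Weil1956, §1]
[cite: WeilBNT1967, Ch. VII §3 (Cor. 1–2 of Prop. 7)] -/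
theorem two_mul_exponent_eq_of_hasInfinityType [IsTotallyComplex K] {χ : HeckeCharacter K}
    {p q : InfinitePlace K → ℤ} (h : χ.HasInfinityType p q) {σ : ℝ}
    (hσ : ∀ y : ideleGroup K, ‖((χ y : ℂˣ) : ℂ)‖ = ideleNorm y ^ σ) (w₀ : InfinitePlace K) :
    2 * σ = -((p w₀ + q w₀ : ℤ) : ℝ) := by
  classical
  have hz0 : (2 : ℂ) ≠ 0 := two_ne_zero
  let e : ℂ ≃+* w₀.Completion := (ringEquivComplexOfIsComplex (IsTotallyComplex.isComplex w₀)).symm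
  let ρ : ℂ →* InfiniteAdeleRing K :=
    (MonoidHom.mulSingle (fun w : InfinitePlace K ↦ w.Completion) w₀).comp (e : ℂ →+* w₀.Completion).toMonoidHom
  let x : (InfiniteAdeleRing K)ˣ := Units.map ρ (Units.mk0 (2 : ℂ) hz0)
  have hx₀ : (x : InfiniteAdeleRing K) w₀ = e 2 := by
    show Pi.mulSingle (M := fun w : InfinitePlace K ↦ w.Completion) w₀ (e 2) w₀ = e 2
    exact Pi.mulSingle_eq_same w₀ (e 2)
  have hx₁ : ∀ w : InfinitePlace K, w ≠ w₀ → (x : InfiniteAdeleRing K) w = 1 := fun w hw' ↦ by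
    show Pi.mulSingle (M := fun w : InfinitePlace K ↦ w.Completion) w₀ (e 2) w = 1
    exact Pi.mulSingle_eq_of_ne hw' _
  have hxw₀ : extensionEmbedding w₀ ((x : InfiniteAdeleRing K) w₀) = 2 := by
    rw [hx₀]
    show extensionEmbedding w₀ ((ringEquivComplexOfIsComplex (IsTotallyComplex.isComplex w₀)).symm 2) = 2
    rw [← ringEquivComplexOfIsComplex_apply (IsTotallyComplex.isComplex w₀), RingEquiv.apply_symm_apply]
  have hxw : ∀ w : InfinitePlace K, w ≠ w₀ → extensionEmbedding w ((x : InfiniteAdeleRing K) w) = 1 :=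
    fun w hw' ↦ by rw [hx₁ w hw', map_one]
  have hpos : InfiniteIdele.IsTotallyPositive x := fun w hw' =>
    absurd hw' (not_isReal_iff_isComplex.mpr (IsTotallyComplex.isComplex w))
  have key := h.apply_infiniteIdeles_eq hpos
  -- norm side: `‖x‖ = 4`
  have hmult : w₀.mult = 2 := by
    rw [InfinitePlace.mult, if_neg (not_isReal_iff_isComplex.mpr (IsTotallyComplex.isComplex w₀))]
  have hN : ideleNorm (infiniteIdeles K x) = (2 : ℝ) ^ (2 : ℕ) := by
    rw [ideleNorm_infiniteIdeles', Finset.prod_eq_single w₀ (fun w _ hw' ↦ by rw [hx₁ w hw', norm_one, one_pow])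
      (fun h' ↦ absurd (Finset.mem_univ w₀) h'), hmult]
    have hiso := (isometry_extensionEmbedding w₀).norm_map_of_map_zero (map_zero _)
      ((x : InfiniteAdeleRing K) w₀)
    rw [← hiso, hxw₀]
    norm_num
  -- type side: `‖χ(x)‖ = 2^{-(p+q)}`
  have h2c : conj (2 : ℂ) = 2 := map_ofNat _ 2
  have htype : ‖((χ (infiniteIdeles K x) : ℂˣ) : ℂ)‖ = (2 : ℝ) ^ (-((p w₀ + q w₀ : ℤ) : ℝ)) := by
    rw [key, archFactor_apply, Finset.prod_eq_single w₀ (fun w _ hw' ↦ by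
      rw [hxw w hw', map_one, one_zpow, one_zpow, mul_one]) (fun h' ↦ absurd (Finset.mem_univ w₀) h'),
      hxw₀, h2c, norm_mul, norm_zpow, norm_zpow, Complex.norm_ofNat, ← Real.rpow_intCast,
      ← Real.rpow_intCast, ← Real.rpow_add two_pos]
    congr 1
    push_cast
    ring
  have heq : (2 : ℝ) ^ (2 * σ) = (2 : ℝ) ^ (-((p w₀ + q w₀ : ℤ) : ℝ)) := by
    rw [← htype, hσ, hN, ← Real.rpow_natCast, ← Real.rpow_mul two_pos.le]
    norm_num
  have hlog := congrArg Real.log heq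
  rw [Real.log_rpow two_pos, Real.log_rpow two_pos] at hlog
  exact mul_right_cancel₀ (Real.log_pos one_lt_two).ne' hlog

/-- **`L(s, χ)` is entire for a character with `p_{w₀} ≠ q_{w₀}` and `p_{w₀} + q_{w₀} ≤ 0` at one infinite place**
(totally complex `K`): then `χ` is not a norm twist and its exponent is `σ = −(p_{w₀} + q_{w₀})/2 ≥ 0`, so
`hasEntireContinuation_heckeLFunction_of_norm_eq_rpow` (Tate's theorem for the unitary part, shifted) gives an
entire continuation of `heckeLFunction χ` (`LFunction.HasEntireContinuation`). For a Katz type `kΣ + κ(1 − c)`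
(`k ≥ 1`, `κ ≥ 0`) at any place: `{p_w, q_w} = {−(k+κ_w), κ_w}`, so `p_w ≠ q_w` and `p_w + q_w = −k ≤ 0` — this
discharges the continuation binder `hL` of the Katz-type frames. (The tree's
`CycTangentCMCycTangentBoundInterpolationContinuation.hasEntireContinuation_of_hasInfinityType` is the imaginary
quadratic, constant-type case.) [cite: TateThesis1967, Thm. 4.4.1] [cite: Weil1956, §1] -/
theorem hasEntireContinuation_heckeLFunction_of_hasInfinityType [IsTotallyComplex K] {χ : HeckeCharacter K}
    {p q : InfinitePlace K → ℤ} (h : χ.HasInfinityType p q) (w₀ : InfinitePlace K) (hw : p w₀ ≠ q w₀)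
    (hle : p w₀ + q w₀ ≤ 0) : LFunction.HasEntireContinuation (heckeLFunction χ) := by
  obtain ⟨σ, hσ⟩ := χ.exists_norm_apply_eq_ideleNorm_rpow
  have h2 := two_mul_exponent_eq_of_hasInfinityType h hσ w₀
  have hsum : ((p w₀ + q w₀ : ℤ) : ℝ) ≤ 0 := by exact_mod_cast hle
  have h0 : 0 ≤ σ := by linarith
  exact hasEntireContinuation_heckeLFunction_of_norm_eq_rpow hσ h0
    (not_isNormTwist_of_hasInfinityType_of_ne h w₀ hw)

end HeckeCharacter

end Literature.NumberTheory.GaloisRepresentations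

end
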